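import Literature.Geometry.Riemannian.AlmostNonnegRicciFibrationReduction
import Literature.Geometry.Manifold.EquivariantCircleDescent
import Literature.Geometry.Manifold.WhitneyApproximation
import Literature.Topology.FourManifolds.CircleMapWindingHomotopy
import HarnessLib

/-!
# Huang–Huang–Wang–Zhu 2026, Main Theorem 1 at `n = 4`, `b₁ = 1`: reduction to an equivariant
function without critical points on the infinite cyclic cover

Third reduction file for the named fact
`Literature.Geometry.Riemannian.huangHuangWangZhu2026_fibresOverCircle_four`
(`AlmostNonnegRicciFibration.lean`; H. Huang, X.-T. Huang, J. Wang, X. Zhu, arXiv:2605.24380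
(2026), Main Theorem 1). The printed proof (§4, pp. 13–14) works on the free-abelian cover
`M̂ → M` with deck group `H ≅ ℤᵇ`: it produces an `H`-equivariant smooth map `Fᵢ : M̂ᵢ → ℝˢ`
("Theorem 1.11 … `Fᵢ` is `Kᵢ`-equivariant"), shows "`dFᵢ` is non-degenerate" (Huang–Huang 2024,
Cor. 7.6), and then "`Fᵢ` descends to the quotient space … a smooth fiber bundle map
`F̂ᵢ : Mᵢ → Tˢ/Kᵢ'`". For `b = s = 1` the cover is the infinite cyclic cover and the torus is the
circle `ℝ/2πℤ`; this file isolates the ANALYTIC content of the theorem as the hypothesis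

> (E) *for every `κ > 0` there is `δ > 0` such that for every closed smooth `P ≃ₕ S¹ × S³` with
> a metric of `diam ≤ 1`, `sec ≥ -κ`, `Ric ≥ -δ g` (verbatim the hypotheses of the fact) and every
> smooth `f₀ : P → S¹` whose infinite cyclic cover `P̂ = CyclicCover f₀` is connected, there is a
> smooth `F : P̂ → ℝ` with `F (k +ᵥ x̂) = F x̂ + 2πk` and `dF ≠ 0` everywhere*

and proves **(E) ⇒ the fact** (`huangHuangWangZhu2026_fibresOverCircle_four_of_equivariant`):

1. a homotopy equivalence `e : P ≃ₕ S¹ × S³` gives the circle map `f₀ᶜ = pr₁ ∘ e` along which the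
   loop `e⁻¹ ∘ (standard generator)` has winding number `1`
   (`exists_winding_eq_one_of_homotopyEquiv`: `e ∘ e⁻¹ ≃ id` and winding numbers along a loop are
   invariant under homotopies of the map, `CircleMapWindingHomotopy.lean`);
2. Whitney approximation (`WhitneyApproximation.lean`, Lee 2012, Thm. 6.26) replaces `f₀ᶜ` by a
   homotopic SMOOTH `f₀`, with the same winding numbers;
3. a loop of winding number one makes the infinite cyclic cover path connected
   (`CyclicCover.pathConnectedSpace_of_winding_eq_one`, `InfiniteCyclicCover.lean`);
4. (E) gives the equivariant `F` on `CyclicCover f₀`, which descends to a smooth submersion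
   `P → S¹` (`exists_submersion_of_equivariant`, `EquivariantCircleDescent.lean`);
5. the connected-fibre clause is free (`huangHuangWangZhu2026_fibresOverCircle_four_of_submersion`,
   `AlmostNonnegRicciFibrationReduction.lean`).

The cover `P̂` with its lifted metric is a complete, proper geodesic Riemannian manifold with
the curvature bounds of `P`, on which `ℤ` acts freely, properly discontinuously, cocompactly and
isometrically, generated by its short elements (`CyclicCoverMetric.lean`,
`CyclicCoverDistance.lean`, `RiemannianCoveringComplete.lean`, `CyclicCoverProper.lean`,
`CyclicCoverCurvature.lean`, `CyclicCoverProperlyDiscontinuous.lean`,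
`CyclicCoverShortGenerators.lean`) — the setting of §4 of the paper for `b = 1`, in which (E) is
to be proved.

Everything is proved; no definitions, no named facts (D-0026): (E) is a HYPOTHESIS of the
reduction theorem, not a vendored fact.

## References

* H. Huang, X.-T. Huang, J. Wang, X. Zhu, arXiv:2605.24380 (2026), Main Theorem 1 (p. 3),
  Theorem 1.11 (pp. 4–5), §4 (pp. 13–14). [HuangHuangWangZhu2026]
* A. Hatcher, *Algebraic Topology*, CUP (2002), §1.1 Thm. 1.7, §1.3 Prop. 1.30–1.40. [HatcherAT2002]
* J. M. Lee, *Introduction to Smooth Manifolds*, 2nd ed. (2012), Thm. 6.26, Prop. 4.40.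
  [LeeSmoothManifolds2013]
-/

noncomputable section

open scoped Manifold ContDiff Topology Real
open Function Set

namespace Literature.Geometry.Riemannian

open Literature.Topology.FourManifolds Literature.Topology.FourManifolds.CircleMaps
  Literature.Topology.FourManifolds.CircleMaps.CyclicCover Literature.Geometry.Manifold

/-- Local notation: the unit circle in `EuclideanSpace ℝ (Fin 2)` (the tree's `𝕊 1`). -/
local notation "𝕊¹" => (Metric.sphere (0 : EuclideanSpace ℝ (Fin 2)) 1)

/-! ### A homotopy equivalence with `S¹ × Z` yields a loop of winding number one -/

/-- **The standard generator has winding number one**: along the loop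
`t ↦ ((cos 2πt, sin 2πt), z₀)` of `𝕊¹ × Z` the circle map `toCircle ∘ pr₁` has winding number `1`
(the lift `t ↦ 2πt`). [cite: HatcherAT2002, §1.1 Thm. 1.7] -/
theorem exists_loop_winding_fst_eq_one {Z : Type*} [TopologicalSpace Z] (z₀ : Z) :
    ∃ ℓ : Path ((circlePoint 0, z₀) : 𝕊¹ × Z) (circlePoint 0, z₀),
      winding (toCircleC.comp (ContinuousMap.fst : C(𝕊¹ × Z, 𝕊¹))) ℓ = 1 := by
  let ℓ : Path ((circlePoint 0, z₀) : 𝕊¹ × Z) (circlePoint 0, z₀) :=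
    { toFun := fun t ↦ (circlePoint (2 * π * t), z₀)
      continuous_toFun := by fun_prop
      source' := by simp
      target' := by
        show (circlePoint (2 * π * (1 : ℝ)), z₀) = (circlePoint 0, z₀)
        rw [mul_one, ← zero_add (2 * π), periodic_circlePoint] }
  refine ⟨ℓ, winding_eq_of_lift _ ℓ (G := fun t ↦ 2 * π * t) (by fun_prop) (fun t ↦ ?_) 1 ?_⟩
  · show Circle.exp (2 * π * t) = toCircle (circlePoint (2 * π * t))
    rw [toCircle_circlePoint]
  · simp only [Set.Icc.coe_one, Set.Icc.coe_zero, mul_one, mul_zero, sub_zero, Int.cast_one,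
      one_mul]

/-- **A homotopy equivalence `e : X ≃ₕ 𝕊¹ × Z` gives a circle map on `X` with a loop of winding
number one**: for `f₀ = toCircle ∘ pr₁ ∘ e` and the loop `γ = e⁻¹ ∘ ℓ`, `ℓ` the standard generator,
`winding f₀ γ = winding (toCircle ∘ pr₁) ((e ∘ e⁻¹) ∘ ℓ) = winding (toCircle ∘ pr₁) ℓ = 1`, since
`e ∘ e⁻¹ ≃ id` and winding numbers along a loop are invariant under homotopies of the map
(`winding_map_eq_of_homotopic`). [cite: HatcherAT2002, Prop. 1.30] -/
theorem exists_winding_eq_one_of_homotopyEquiv {X Z : Type*} [TopologicalSpace X]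
    [TopologicalSpace Z] [Nonempty Z] (e : ContinuousMap.HomotopyEquiv X (𝕊¹ × Z)) :
    ∃ (x₀ : X) (γ : Path x₀ x₀),
      winding ((toCircleC.comp (ContinuousMap.fst : C(𝕊¹ × Z, 𝕊¹))).comp e.toFun) γ = 1 := by
  obtain ⟨z₀⟩ := (inferInstance : Nonempty Z)
  obtain ⟨ℓ, hℓ⟩ := exists_loop_winding_fst_eq_one z₀
  set F : C(𝕊¹ × Z, Circle) := toCircleC.comp (ContinuousMap.fst : C(𝕊¹ × Z, 𝕊¹)) with hF
  refine ⟨e.invFun (circlePoint 0, z₀), ℓ.map e.invFun.continuous, ?_⟩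
  calc winding (F.comp e.toFun) (ℓ.map e.invFun.continuous)
      = winding F (ℓ.map (e.toFun.comp e.invFun).continuous) :=
        winding_congr _ _ _ _ fun _ ↦ rfl
    _ = winding F (ℓ.map (ContinuousMap.id (𝕊¹ × Z)).continuous) :=
        winding_map_eq_of_homotopic F e.right_inv ℓ
    _ = winding F ℓ := winding_congr _ _ _ _ fun _ ↦ rfl
    _ = 1 := hℓ

/-- **Homotopic circle maps have the same winding numbers** along every loop.
[cite: HatcherAT2002, Prop. 1.30] -/
theorem winding_eq_of_homotopic_maps {X : Type*} [TopologicalSpace X] {f₀ f₁ : C(X, Circle)}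
    (h : f₀.Homotopic f₁) {x₀ : X} (γ : Path x₀ x₀) : winding f₀ γ = winding f₁ γ := by
  have h0 : winding f₀ γ = winding (ContinuousMap.id Circle) (γ.map f₀.continuous) :=
    winding_congr _ _ _ _ fun _ ↦ rfl
  have h1 : winding f₁ γ = winding (ContinuousMap.id Circle) (γ.map f₁.continuous) :=
    winding_congr _ _ _ _ fun _ ↦ rfl
  rw [h0, h1]
  exact winding_map_eq_of_homotopic (ContinuousMap.id Circle) h γ

/-- **A closed smooth manifold homotopy equivalent to `𝕊¹ × Z` (e.g. `S¹ × S³`) carries a SMOOTH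
circle map whose infinite cyclic cover is path connected**: smooth `f₀ : P → S¹` homotopic to
`pr₁ ∘ e` (Whitney approximation, Lee 2012, Thm. 6.26), along which the loop `e⁻¹ ∘ ℓ` still has
winding number one, so that `CyclicCover f₀` is path connected
(`CyclicCover.pathConnectedSpace_of_winding_eq_one`). [cite: LeeSmoothManifolds2013, Thm. 6.26] -/
theorem exists_contMDiff_pathConnectedSpace_cyclicCover
    {EM HM : Type*} [NormedAddCommGroup EM] [NormedSpace ℝ EM] [FiniteDimensional ℝ EM]
    [TopologicalSpace HM] {IM : ModelWithCorners ℝ EM HM} {P : Type*} [TopologicalSpace P]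
    [ChartedSpace HM P] [IsManifold IM ∞ P] [CompactSpace P] [T2Space P] [PathConnectedSpace P]
    {Z : Type*} [TopologicalSpace Z] [Nonempty Z] (e : ContinuousMap.HomotopyEquiv P (𝕊¹ × Z)) :
    ∃ f₀ : C(P, Circle), ContMDiff IM (𝓡 1) ∞ f₀ ∧ PathConnectedSpace (CyclicCover f₀) := by
  obtain ⟨x₀, γ, hγ⟩ := exists_winding_eq_one_of_homotopyEquiv e
  obtain ⟨f₀, hf₀, hhom⟩ := exists_contMDiff_homotopic (IM := IM) (IN := 𝓡 1)
    ((toCircleC.comp (ContinuousMap.fst : C(𝕊¹ × Z, 𝕊¹))).comp e.toFun)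
  refine ⟨f₀, hf₀, CyclicCover.pathConnectedSpace_of_winding_eq_one γ ?_⟩
  rw [← winding_eq_of_homotopic_maps hhom γ, hγ]

/-! ### Equivariance for the generator; the period of a function without critical points -/

section Period

variable {X : Type*} [TopologicalSpace X] {f : C(X, Circle)}

/-- Equivariance for the generator `1 ∈ ℤ` gives equivariance for all of `ℤ`:
`F (1 +ᵥ x̂) = F x̂ + c` for all `x̂` implies `F (k +ᵥ x̂) = F x̂ + k c`. [folklore] -/
theorem apply_vadd_eq_add_mul_of_apply_one_vadd {F : CyclicCover f → ℝ} {c : ℝ}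
    (hF : ∀ x : CyclicCover f, F ((1 : ℤ) +ᵥ x) = F x + c) (k : ℤ) (x : CyclicCover f) :
    F (k +ᵥ x) = F x + k * c := by
  induction k using Int.induction_on generalizing x with
  | zero => simp
  | succ n ih =>
    rw [add_comm (n : ℤ) 1, add_vadd, hF, ih]
    push_cast
    ring
  | pred n ih =>
    have h := hF ((-(n : ℤ) - 1) +ᵥ x)
    rw [← add_vadd, show (1 : ℤ) + (-(n : ℤ) - 1) = -(n : ℤ) by ring, ih] at h
    push_cast at h ⊢
    linarith

/-- **An invariant continuous function on the cyclic cover of a compact space attains its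
maximum** (it descends to the compact base through the quotient map `proj`). [folklore] -/
theorem exists_isMaxOn_of_invariant [CompactSpace X] {F : CyclicCover f → ℝ} (hFc : Continuous F)
    (hF : ∀ x : CyclicCover f, F ((1 : ℤ) +ᵥ x) = F x) (x₀ : CyclicCover f) :
    ∃ x₁ : CyclicCover f, IsMaxOn F univ x₁ := by
  have hk : ∀ (k : ℤ) (x : CyclicCover f), F (k +ᵥ x) = F x := fun k x ↦ by
    have h := apply_vadd_eq_add_mul_of_apply_one_vadd (F := F) (c := 0)
      (fun x ↦ by rw [hF, add_zero]) k x
    rwa [mul_zero, add_zero] at h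
  -- `F` descends to `φ : X → ℝ`
  set φ : X → ℝ := fun y ↦ F (base f y) with hφ
  have hφF : ∀ x : CyclicCover f, φ (proj x) = F x := fun x ↦ by
    obtain ⟨k, hk'⟩ := exists_vadd_eq_of_proj_eq (proj_base (f := f) (proj x))
    show F (base f (proj x)) = F x
    rw [← hk', hk]
  have hφc : Continuous φ := by
    rw [(isQuotientMap_proj (f := f)).continuous_iff]
    have : φ ∘ proj = F := funext hφF
    rw [this]
    exact hFc
  haveI : Nonempty X := ⟨proj x₀⟩
  obtain ⟨y₁, -, hy₁⟩ := (isCompact_univ (X := X)).exists_isMaxOn univ_nonempty hφc.continuousOn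
  refine ⟨base f y₁, fun x _ ↦ ?_⟩
  show F x ≤ F (base f y₁)
  rw [← hφF x]
  exact hy₁ (mem_univ (proj x))

variable {E : Type*} [NormedAddCommGroup E] [NormedSpace ℝ E]
  {H : Type*} [TopologicalSpace H] {I : ModelWithCorners ℝ E H} [I.Boundaryless]
  [ChartedSpace H X]

/-- **The period of a function without critical points is non-zero**: on the cyclic cover of a
compact manifold, a differentiable `F` with `F (1 +ᵥ x̂) = F x̂ + c` and `dF ≠ 0` everywhere has
`c ≠ 0` — otherwise `F` is invariant, attains a maximum, and `dF = 0` there (Fermat).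
[folklore] -/
theorem period_ne_zero [CompactSpace X] {F : CyclicCover f → ℝ} {c : ℝ} (hFc : Continuous F)
    (hF : ∀ x : CyclicCover f, F ((1 : ℤ) +ᵥ x) = F x + c)
    (hdF : ∀ x, mfderiv I 𝓘(ℝ, ℝ) F x ≠ 0) (x₀ : CyclicCover f) : c ≠ 0 := by
  rintro rfl
  obtain ⟨x₁, hmax⟩ := exists_isMaxOn_of_invariant hFc (fun x ↦ by rw [hF, add_zero]) x₀
  exact hdF x₁ (mfderiv_eq_zero_of_isMaxOn_univ hmax)

omit [I.Boundaryless] in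
/-- **Normalising the period**: from a `C^n` function `F` with `F (1 +ᵥ x̂) = F x̂ + c`, `c ≠ 0`,
and `dF ≠ 0` everywhere, the rescaled `(2π/c) F` is `2π`-equivariant under all of `ℤ` and still
has no critical points. [folklore] -/
theorem exists_two_pi_equivariant {n : ℕ∞ω} {F : CyclicCover f → ℝ} {c : ℝ} (hc : c ≠ 0)
    (hFs : ContMDiff I 𝓘(ℝ, ℝ) n F) (hn : n ≠ 0)
    (hF : ∀ x : CyclicCover f, F ((1 : ℤ) +ᵥ x) = F x + c)
    (hdF : ∀ x, mfderiv I 𝓘(ℝ, ℝ) F x ≠ 0) :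
    ∃ F' : CyclicCover f → ℝ, ContMDiff I 𝓘(ℝ, ℝ) n F' ∧
      (∀ (k : ℤ) (x : CyclicCover f), F' (k +ᵥ x) = F' x + k * (2 * π)) ∧
      ∀ x, mfderiv I 𝓘(ℝ, ℝ) F' x ≠ 0 := by
  refine ⟨fun x ↦ 0 + (2 * π / c) * F x, contMDiff_const.add (contMDiff_const.mul hFs),
    fun k x ↦ ?_, fun x ↦ ?_⟩
  · show 0 + 2 * π / c * F (k +ᵥ x) = (0 + 2 * π / c * F x) + k * (2 * π)
    rw [apply_vadd_eq_add_mul_of_apply_one_vadd hF k x]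
    field_simp
    ring
  · exact (mfderiv_const_add_const_mul_ne_zero_iff ((hFs x).mdifferentiableAt hn) 0
      (by positivity : 2 * π / c ≠ 0)).2 (hdF x)

end Period

/-! ### The reduction -/

/-- **Huang–Huang–Wang–Zhu 2026, Main Theorem 1 (`n = 4`, `P ≃ₕ S¹ × S³`), reduced to its
equivariant analytic core.** Suppose (E): for every `κ > 0` there is `δ > 0` such that for every
closed smooth 4-manifold `P ≃ₕ S¹ × S³` with a `C^∞` Riemannian metric of `diam ≤ 1`,
`sec ≥ -κ`, `Ric ≥ -δ g` (the hypotheses of the named fact, verbatim) and every smooth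
`f₀ : P → S¹` with connected infinite cyclic cover `P̂ = CyclicCover f₀`, there is a smooth
`F : P̂ → ℝ`, equivariant (`F (k +ᵥ x̂) = F x̂ + 2πk`) and without critical points — in the paper
this is Theorem 1.11 (the `Hᵢ`-equivariant smooth `Fᵢ : M̂ᵢ → ℝˢ`, §4 p. 14) together with
Huang–Huang 2024, Cor. 7.6 ("`dFᵢ` is non-degenerate"), for `b = s = 1`. Then the named fact
`huangHuangWangZhu2026_fibresOverCircle_four` holds (with the same `δ`): `P` is path connected,
a smooth `f₀` with connected cyclic cover exists (`exists_contMDiff_pathConnectedSpace_cyclicCover`),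
the equivariant `F` descends to a smooth submersion `P → S¹` ("`Fᵢ` descends to the quotient",
`exists_submersion_of_equivariant`) and the connected-fibre clause is free
(`huangHuangWangZhu2026_fibresOverCircle_four_of_submersion`).
[cite: HuangHuangWangZhu2026, Main Theorem 1 (p. 3), Theorem 1.11 and §4 p. 14] -/
theorem huangHuangWangZhu2026_fibresOverCircle_four_of_equivariant
    (H : ∀ κ : ℝ, 0 < κ → ∃ δ : ℝ, 0 < δ ∧ ∀ (P : Type) [TopologicalSpace P] [T2Space P]
      [SecondCountableTopology P] [ChartedSpace (EuclideanSpace ℝ (Fin 4)) P] [IsManifold (𝓡 4) ∞ P]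
      [CompactSpace P],
      ContinuousMap.HomotopyEquiv P ((Metric.sphere (0 : EuclideanSpace ℝ (Fin 2)) 1) × (Metric.sphere (0 : EuclideanSpace ℝ (Fin 4)) 1)) →
      ∀ (g : Bundle.ContMDiffRiemannianMetric (𝓡 4) ∞ (EuclideanSpace ℝ (Fin 4)) (TangentSpace (𝓡 4) : P → Type _))
      [(Literature.Geometry.Lorentzian.PseudoRiemannianMetric.ofRiemannian g).HasLeviCivita],
      (open Bundle in letI : Bundle.RiemannianBundle (fun x : P ↦ TangentSpace (𝓡 4) x) :=
      ⟨g.toContinuousRiemannianMetric.toRiemannianMetric⟩; ∀ x y : P, Manifold.riemannianEDist (𝓡 4) x y ≤ 1) →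
      (∀ (x : P) (X Y : TangentSpace (𝓡 4) x),
      -κ * (g.inner x X X * g.inner x Y Y - g.inner x X Y ^ 2) ≤
      (Literature.Geometry.Lorentzian.PseudoRiemannianMetric.ofRiemannian g).curvatureForm
      (Literature.Geometry.Lorentzian.PseudoRiemannianMetric.ofRiemannian g).leviCivita x X Y Y X) →
      (∀ (x : P) (w : TangentSpace (𝓡 4) x),
      -δ * g.inner x w w ≤ (Literature.Geometry.Lorentzian.PseudoRiemannianMetric.ofRiemannian g).ricci x w w) →
      ∀ f₀ : C(P, Circle), ContMDiff (𝓡 4) (𝓡 1) ∞ f₀ → ConnectedSpace (CyclicCover f₀) →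
        ∃ F : CyclicCover f₀ → ℝ, ContMDiff (𝓡 4) 𝓘(ℝ, ℝ) ∞ F ∧
          (∀ (k : ℤ) (x : CyclicCover f₀), F (k +ᵥ x) = F x + k * (2 * π)) ∧
          ∀ x : CyclicCover f₀, mfderiv (𝓡 4) 𝓘(ℝ, ℝ) F x ≠ 0) :
    huangHuangWangZhu2026_fibresOverCircle_four := by
  apply huangHuangWangZhu2026_fibresOverCircle_four_of_submersion
  intro κ hκ
  obtain ⟨δ, hδ, hP⟩ := H κ hκ
  refine ⟨δ, hδ, ?_⟩
  intro P _ _ _ _ _ _ e g _ hdiam hsec hric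
  -- `P` is path connected
  haveI : PathConnectedSpace (Metric.sphere (0 : EuclideanSpace ℝ (Fin 2)) 1) := by
    refine isPathConnected_iff_pathConnectedSpace.mp (isPathConnected_sphere ?_ _ zero_le_one)
    rw [← Module.finrank_eq_rank, finrank_euclideanSpace_fin]
    norm_num
  haveI : PathConnectedSpace (Metric.sphere (0 : EuclideanSpace ℝ (Fin 4)) 1) := by
    refine isPathConnected_iff_pathConnectedSpace.mp (isPathConnected_sphere ?_ _ zero_le_one)
    rw [← Module.finrank_eq_rank, finrank_euclideanSpace_fin]
    norm_num
  haveI : PathConnectedSpace P := pathConnectedSpace_of_homotopyEquiv e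
  -- a smooth circle map with connected infinite cyclic cover
  obtain ⟨f₀, hf₀, hconn⟩ := exists_contMDiff_pathConnectedSpace_cyclicCover (IM := 𝓡 4) e
  haveI := hconn
  -- the equivariant function and its descent
  obtain ⟨F, hF, hFeq, hdF⟩ := hP P e g hdiam hsec hric f₀ hf₀ inferInstance
  obtain ⟨G, hG, hGsub, -⟩ :=
    exists_submersion_of_equivariant f₀ (n := ⊤) (by simp) hFeq hF hdF
  exact ⟨G, hG, hGsub⟩

/-- **The same reduction with the weakest equivariance data**: it suffices that, in the situation
of the fact, for every smooth `f₀ : P → S¹` with connected infinite cyclic cover there be a smooth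
`F : P̂ → ℝ` without critical points which is equivariant for the GENERATOR of the deck group up
to SOME period, `F (1 +ᵥ x̂) = F x̂ + c` (the period is automatically non-zero, `period_ne_zero`,
and can be normalised to `2π`, `exists_two_pi_equivariant`). In Huang–Huang–Wang–Zhu 2026, §4
(p. 14) such an `F` is the lift to `M̂ᵢ` of the `Kᵢ`-equivariant fibration
`Fᵢ : τᵢ⁻¹(Mᵢ) → T¹` of the finite intermediate cover.
[cite: HuangHuangWangZhu2026, Main Theorem 1 (p. 3), Theorem 1.11 and §4 p. 14] -/
theorem huangHuangWangZhu2026_fibresOverCircle_four_of_generator_equivariant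
    (H : ∀ κ : ℝ, 0 < κ → ∃ δ : ℝ, 0 < δ ∧ ∀ (P : Type) [TopologicalSpace P] [T2Space P]
      [SecondCountableTopology P] [ChartedSpace (EuclideanSpace ℝ (Fin 4)) P] [IsManifold (𝓡 4) ∞ P]
      [CompactSpace P],
      ContinuousMap.HomotopyEquiv P ((Metric.sphere (0 : EuclideanSpace ℝ (Fin 2)) 1) × (Metric.sphere (0 : EuclideanSpace ℝ (Fin 4)) 1)) →
      ∀ (g : Bundle.ContMDiffRiemannianMetric (𝓡 4) ∞ (EuclideanSpace ℝ (Fin 4)) (TangentSpace (𝓡 4) : P → Type _))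
      [(Literature.Geometry.Lorentzian.PseudoRiemannianMetric.ofRiemannian g).HasLeviCivita],
      (open Bundle in letI : Bundle.RiemannianBundle (fun x : P ↦ TangentSpace (𝓡 4) x) :=
      ⟨g.toContinuousRiemannianMetric.toRiemannianMetric⟩; ∀ x y : P, Manifold.riemannianEDist (𝓡 4) x y ≤ 1) →
      (∀ (x : P) (X Y : TangentSpace (𝓡 4) x),
      -κ * (g.inner x X X * g.inner x Y Y - g.inner x X Y ^ 2) ≤
      (Literature.Geometry.Lorentzian.PseudoRiemannianMetric.ofRiemannian g).curvatureForm
      (Literature.Geometry.Lorentzian.PseudoRiemannianMetric.ofRiemannian g).leviCivita x X Y Y X) →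
      (∀ (x : P) (w : TangentSpace (𝓡 4) x),
      -δ * g.inner x w w ≤ (Literature.Geometry.Lorentzian.PseudoRiemannianMetric.ofRiemannian g).ricci x w w) →
      ∀ f₀ : C(P, Circle), ContMDiff (𝓡 4) (𝓡 1) ∞ f₀ → ConnectedSpace (CyclicCover f₀) →
        ∃ F : CyclicCover f₀ → ℝ, ContMDiff (𝓡 4) 𝓘(ℝ, ℝ) ∞ F ∧
          (∃ c : ℝ, ∀ x : CyclicCover f₀, F ((1 : ℤ) +ᵥ x) = F x + c) ∧
          ∀ x : CyclicCover f₀, mfderiv (𝓡 4) 𝓘(ℝ, ℝ) F x ≠ 0) :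
    huangHuangWangZhu2026_fibresOverCircle_four := by
  apply huangHuangWangZhu2026_fibresOverCircle_four_of_equivariant
  intro κ hκ
  obtain ⟨δ, hδ, hP⟩ := H κ hκ
  refine ⟨δ, hδ, ?_⟩
  intro P _ _ _ _ _ _ e g _ hdiam hsec hric f₀ hf₀ hconn
  obtain ⟨F, hF, ⟨c, hFc⟩, hdF⟩ := hP P e g hdiam hsec hric f₀ hf₀ hconn
  -- a point of the (connected, hence nonempty) cover; the period is non-zero; normalise it
  obtain ⟨x₀⟩ := hconn.toNonempty
  have hc : c ≠ 0 := period_ne_zero hF.continuous hFc hdF x₀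
  exact exists_two_pi_equivariant hc hF (by simp) hFc hdF

end Literature.Geometry.Riemannian
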